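import Mathlib.Tactic
import HarnessLib

/-!
# `x² + y² + z² = a·xyz` has positive solutions only for `a ∈ {1, 3}` (Hurwitz; Mordell, Ch. 13 §4)

L. J. Mordell, *Diophantine Equations* (1969) [Mordell1969], Ch. 13, §4, equation (19)
`x² + y² + z² − axyz = b` with `b = −c ≤ 0` (pp. 106–107): from a solution one passes to
`(x, y, axy − z)` ("elementary operations"); for a fundamental solution `0 < x ≤ y ≤ z ≤ axy − z` one
gets `axy/3 ≤ z ≤ axy/2` and `2y²(a²x²/9 − 1) ≤ c`, hence *"If `c = 0`, then `x = 3/a` and so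
`a = 3` or `1` … We note that when `c = 0` and `a > 0`, solutions occur only when `a = 1, 3`"*
(Markoff's equation `a = 3`, fundamental solution `(1, 1, 1)`; `a = 1`, fundamental solution
`(3, 3, 3)`; the general study is Hurwitz's). Everything here is a `theorem`; the proof is the printed
descent on the height `x + y + z`.
-/

namespace Literature.NumberTheory.DiophantineGeometry

namespace MarkoffHurwitz

/-- **The fundamental case** (Mordell, Ch. 13 §4, (21)–(23) with `c = 0`): if `z ≥ x, y` and the
elementary operation does not decrease the height (`axy − z ≥ z`), then `a = 1` or `a = 3`.
[cite: Mordell1969, Ch. 13, §4, eqs. (21)–(23)] -/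
theorem fundamental {a x y z : ℤ} (hx : 0 < x) (hy : 0 < y) (hz : 0 < z) (hxz : x ≤ z) (hyz : y ≤ z)
    (h : x ^ 2 + y ^ 2 + z ^ 2 = a * x * y * z) (hfund : 2 * z ≤ a * x * y) : a = 1 ∨ a = 3 := by
  set P := a * x * y with hP
  -- `P ≤ 3z` from `x, y ≤ z`
  have hPz : P * z = x ^ 2 + y ^ 2 + z ^ 2 := by rw [hP]; linarith
  have hP3 : P ≤ 3 * z := by nlinarith
  -- `(P − 2z)² = P² − 4(x² + y²)` and `0 ≤ P − 2z ≤ P/3`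
  have hsq : (P - 2 * z) ^ 2 = P ^ 2 - 4 * (x ^ 2 + y ^ 2) := by nlinarith
  have h9 : 9 * (P - 2 * z) ^ 2 ≤ P ^ 2 := by nlinarith
  have hxy2 : 2 * P ^ 2 ≤ 9 * (x ^ 2 + y ^ 2) := by nlinarith
  -- hence `a · min(x, y) ≤ 3`
  have hP0 : 0 ≤ P := by linarith
  have key : P ≤ 3 * y ∨ P ≤ 3 * x := by
    rcases le_total x y with hxy | hxy
    · left
      by_contra hlt
      rw [not_le] at hlt
      nlinarith
    · right
      by_contra hlt
      rw [not_le] at hlt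
      nlinarith
  have ha0 : 0 < a := by
    by_contra hle
    rw [not_lt] at hle
    have : a * x * y * z ≤ 0 := by
      have := mul_nonneg (mul_nonneg (neg_nonneg.mpr hle) hx.le) hy.le
      nlinarith
    nlinarith [sq_nonneg x, sq_nonneg y, sq_nonneg z]
  have hamin : a * x ≤ 3 ∨ a * y ≤ 3 := by
    rcases key with k | k
    · left; rw [hP] at k; nlinarith
    · right
      rw [hP] at k
      have : a * y * x ≤ 3 * x := by linarith
      nlinarith
  -- `a ≤ 3`, and `a = 2` is impossible (`1 + y² + z² = 2yz`)
  have ha3 : a ≤ 3 := by rcases hamin with k | k <;> nlinarith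
  have ha2 : a ≠ 2 := by
    rintro rfl
    rcases hamin with k | k
    · have hx1 : x = 1 := by omega
      subst hx1
      nlinarith [sq_nonneg (y - z)]
    · have hy1 : y = 1 := by omega
      subst hy1
      nlinarith [sq_nonneg (x - z)]
  omega

/-- **Mordell, Ch. 13 §4 (Hurwitz): `x² + y² + z² = a·xyz` with `x, y, z > 0` forces `a = 1` or
`a = 3`.** [cite: Mordell1969, Ch. 13, §4 ("when c = 0 and a > 0, solutions occur only when a = 1, 3")] -/
theorem eq_one_or_eq_three {a x y z : ℤ} (hx : 0 < x) (hy : 0 < y) (hz : 0 < z)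
    (h : x ^ 2 + y ^ 2 + z ^ 2 = a * x * y * z) : a = 1 ∨ a = 3 := by
  -- descent on the height `x + y + z`
  suffices H : ∀ (n : ℕ) (x y z : ℤ), 0 < x → 0 < y → 0 < z → (x + y + z).toNat ≤ n →
      x ^ 2 + y ^ 2 + z ^ 2 = a * x * y * z → a = 1 ∨ a = 3 from
    H _ x y z hx hy hz le_rfl h
  intro n
  induction n using Nat.strong_induction_on with
  | _ n ih =>
    intro x y z hx hy hz hn h
    -- put the largest variable last
    have main : ∀ x y z : ℤ, 0 < x → 0 < y → 0 < z → x ≤ z → y ≤ z → (x + y + z).toNat ≤ n →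
        x ^ 2 + y ^ 2 + z ^ 2 = a * x * y * z → a = 1 ∨ a = 3 := by
      intro x y z hx hy hz hxz hyz hn h
      rcases le_or_gt (2 * z) (a * x * y) with hf | hf
      · exact fundamental hx hy hz hxz hyz h hf
      · -- the elementary operation `z ↦ axy − z` lowers the height
        set z' := a * x * y - z with hz'
        have hzz' : z * z' = x ^ 2 + y ^ 2 := by rw [hz']; linear_combination -h
        have hz'pos : 0 < z' := by
          have : 0 < z * z' := by rw [hzz']; positivity
          exact pos_of_mul_pos_right this hz.le
        have h' : x ^ 2 + y ^ 2 + z' ^ 2 = a * x * y * z' := by rw [hz']; linear_combination h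
        have hlt : (x + y + z').toNat < n := by
          have : x + y + z' < x + y + z := by linarith
          have h1 : (x + y + z').toNat < (x + y + z).toNat := by
            rw [Int.lt_toNat]; rw [Int.toNat_of_nonneg (by linarith)]; exact this
          omega
        exact ih _ hlt x y z' hx hy hz'pos le_rfl h'
    rcases le_total x z with hxz | hzx <;> rcases le_total y z with hyz | hzy
    · exact main x y z hx hy hz hxz hyz hn h
    · -- `y` is the largest
      rcases le_total x y with hxy | hyx
      · exact main x z y hx hz hy hxy hzy (by rwa [add_right_comm]) (by linear_combination h)
      · exact main x z y hx hz hy (le_trans hxz hzy) hzy (by rwa [add_right_comm])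
          (by linear_combination h)
    · -- `x` is the largest
      rcases le_total y x with hyx | hxy
      · exact main y z x hy hz hx hyx hzx (by rwa [show y + z + x = x + y + z by ring])
          (by linear_combination h)
      · exact main y z x hy hz hx (le_trans hyz (hzx)) hzx
          (by rwa [show y + z + x = x + y + z by ring]) (by linear_combination h)
    · -- both `x, y ≥ z`: the largest of `x, y`
      rcases le_total x y with hxy | hyx
      · exact main x z y hx hz hy hxy hzy (by rwa [add_right_comm]) (by linear_combination h)
      · exact main y z x hy hz hx hyx hzx (by rwa [show y + z + x = x + y + z by ring])
          (by linear_combination h)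

/-- The two values do occur: `(1,1,1)` for `a = 3` (Markoff) and `(3,3,3)` for `a = 1`.
[cite: Mordell1969, Ch. 13, §4] -/
theorem examples : (1:ℤ) ^ 2 + 1 ^ 2 + 1 ^ 2 = 3 * 1 * 1 * 1 ∧ (3:ℤ) ^ 2 + 3 ^ 2 + 3 ^ 2 = 1 * 3 * 3 * 3 := by
  norm_num

end MarkoffHurwitz

end Literature.NumberTheory.DiophantineGeometry
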